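import Literature.AnabelianGeometry.SemiGraphs.TemperedCompactPairExitsUnbounded
import Literature.AnabelianGeometry.SemiGraphs.TemperedCompactPairInteriorInfiniteValence
import HarnessLib

/-!
# In the residual of [SemiAnbd] Thm 3.7 (iv) the intersection `K₁ ⊓ K₂` FIXES INFINITELY MANY BRANCHES at a vertex of
# EVERY deep level (a group-theoretic handle on the residual: the action factors through a finite quotient at each level)

Mochizuki, *Semi-graphs of anabelioids*, Publ. RIMS **42** (2006), §3, Theorem 3.7 (iv) p. 41: "The maximal
compact subgroups of `π₁^temp(𝒢)` are precisely the verticial subgroups. The nontrivial intersections of two distinct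
maximal compact subgroups of `π₁^temp(𝒢)` are precisely the edge-like subgroups." [cite: MochizukiSemiAnbd2006, Thm 3.7(iv) p.41].

PROOF-ONLY tool file (abc-iut cell, layer L3, row «T37iv-S2@FINITE-CORE-CLASS», file F13, seat abc-iut-L3-t8 gen 12;
no definition, no named fact).  Canonical chart of ANY countable `𝒢` with the hypotheses of Thm 3.7; `K₁`, `K₂`
COMPACT with `C := K₁ ⊓ K₂ ≠ 1`.  Sharpening of F8's `not_finite_star_of_mem_path` (abc-iut-L3-t8 gen 11): if `K₁`
fixes `a₀`, `K₂` fixes `b₀` in `𝒢_{∞,m}` and `z` is a vertex of the path from `a₀` to `b₀` fixed by NEITHER, then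
not only does `z` lie over a base vertex of infinite valence — `C` itself FIXES INFINITELY MANY BRANCHES AT `z`
(`infinite_fixed_branches_of_mem_path`): the images at `z` of the `C`-fixed unfolded pairs of the deeper levels (F8
`exists_unfolded_crossing_of_mem_path`) are `C`-fixed by equivariance of the transitions, and cannot stay in a finite
set (F7 `false_of_forall_unfolded_mem_finite`).  Since `C` acts on `𝒢_{∞,m}` through a FINITE quotient (open
kernels), this is the handle a carrier-level refutation or exclusion of the residual has to meet at every level;
the sequel F14 `TemperedCompactPairNullEdgeGroups.lean` turns it into a class theorem (edge groups forming null
sequences in the vertex groups ⇒ the residual is empty at every base graph).  Honest framing: generic statements about OUR typed `π₁^temp`; nothing here bears on [IUTchIII] Cor. 3.12; no side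
taken; typed ≠ proved.
-/
noncomputable section

open CategoryTheory Topology

namespace Literature.AnabelianGeometry.SemiGraphs

open SimpleGraph

universe u

namespace ProfiniteSemiGraph

variable {𝒢 : ProfiniteSemiGraph.{u}}

/-- ★ **`K₁ ⊓ K₂` fixes infinitely many branches at every vertex of a bridge path fixed by neither subgroup.**  Let
`𝒢` satisfy the hypotheses of Thm 3.7, `K₁, K₂ ≤ π₁^temp(𝒢)` be COMPACT with `K₁ ⊓ K₂ ≠ 1`, `K₁` fixing `a₀` and
`K₂` fixing `b₀` in `𝒢_{∞,m}`, and `z` a vertex of the path from `a₀` to `b₀` fixed by NEITHER.  Then the set of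
branches at `z` fixed by every element of `K₁ ⊓ K₂` is INFINITE (the images of the `K₁ ⊓ K₂`-fixed unfolded pairs over
`z` of all deeper levels are fixed branches at `z`, by equivariance of the transitions, and leave every finite set by
F7). [cite: MochizukiSemiAnbd2006, Thm 3.7(iv) p.41] -/
theorem infinite_fixed_branches_of_mem_path (h37 : 𝒢.Thm37Hypotheses)
    (K₁ K₂ : Subgroup ((𝒢.galoisLevelData h37.toProp36Hypotheses).temperedPi h37.toProp36Hypotheses.isCountable))
    (hK₁ : IsCompact (K₁ : Set ((𝒢.galoisLevelData h37.toProp36Hypotheses).temperedPi h37.toProp36Hypotheses.isCountable)))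
    (hK₂ : IsCompact (K₂ : Set ((𝒢.galoisLevelData h37.toProp36Hypotheses).temperedPi h37.toProp36Hypotheses.isCountable)))
    (hne : K₁ ⊓ K₂ ≠ ⊥) (m : ℕ)
    {a₀ b₀ : ((𝒢.galoisLevelData h37.toProp36Hypotheses).tree m).Vertex}
    (ha₀ : ∀ k ∈ K₁, ((𝒢.galoisLevelData h37.toProp36Hypotheses).treeAct h37.toProp36Hypotheses.isCountable m
      k).hom.vertexMap a₀ = a₀)
    (hb₀ : ∀ k ∈ K₂, ((𝒢.galoisLevelData h37.toProp36Hypotheses).treeAct h37.toProp36Hypotheses.isCountable m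
      k).hom.vertexMap b₀ = b₀)
    (p : ((𝒢.galoisLevelData h37.toProp36Hypotheses).tree m).subdivision.Walk (Sum.inl a₀) (Sum.inl b₀))
    (hp : p.IsPath) (z : ((𝒢.galoisLevelData h37.toProp36Hypotheses).tree m).Vertex)
    (hz : (Sum.inl z : ((𝒢.galoisLevelData h37.toProp36Hypotheses).tree m).Node) ∈ p.support)
    (hz₁ : ¬ ∀ k ∈ K₁, ((𝒢.galoisLevelData h37.toProp36Hypotheses).treeAct h37.toProp36Hypotheses.isCountable m
      k).hom.vertexMap z = z)
    (hz₂ : ¬ ∀ k ∈ K₂, ((𝒢.galoisLevelData h37.toProp36Hypotheses).treeAct h37.toProp36Hypotheses.isCountable m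
      k).hom.vertexMap z = z) :
    ¬ {γ : ((𝒢.galoisLevelData h37.toProp36Hypotheses).tree m).Branch |
        ((𝒢.galoisLevelData h37.toProp36Hypotheses).tree m).abuts γ = some z ∧
        ∀ g ∈ K₁ ⊓ K₂, ((𝒢.galoisLevelData h37.toProp36Hypotheses).treeAct h37.toProp36Hypotheses.isCountable m
          g).hom.branchMap γ = γ}.Finite := by
  classical
  intro hfin
  have h36 := h37.toProp36Hypotheses
  let Dg := 𝒢.galoisLevelData h36
  have hc := h36.isCountable
  let D₀ : VerticialLevelData.{0} 𝒢 (𝒢.temperedPiChart h36) := verticialLevelData_temperedPiChart (h36 := h36)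
  haveI : T2Space (Dg.temperedPi hc) := Dg.t2Space_temperedPi hc
  have hCc : IsCompact ((K₁ ⊓ K₂ : Subgroup _) : Set (Dg.temperedPi hc)) := by
    rw [Subgroup.coe_inf]; exact hK₁.inter_right hK₂.isClosed
  -- equivariance of the transitions on branches: images of fixed branches are fixed
  have hpushB : ∀ {M : ℕ} (h : m ≤ M) (g : Dg.temperedPi hc) (b : (Dg.tree M).Branch),
      (Dg.treeAct hc M g).hom.branchMap b = b →
      (Dg.treeAct hc m g).hom.branchMap ((Dg.treeTrans h).branchMap b) = (Dg.treeTrans h).branchMap b := by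
    intro M h g b hb
    have e := congrArg (fun φ => SemiGraph.Hom.branchMap φ b) (Dg.treeTrans_act hc h g)
    simp only [SemiGraph.comp_branchMap, Function.comp_apply, hb] at e
    exact e.symm
  refine false_of_forall_unfolded_mem_finite h37 (K₁ ⊓ K₂) hCc hne m z _ hfin fun M hmM => ?_
  obtain ⟨v, hv⟩ := D₀.exists_forall_mem_fixed_vertex_of_isCompact K₁ hK₁ M
  obtain ⟨u, hu⟩ := D₀.exists_forall_mem_fixed_vertex_of_isCompact K₂ hK₂ M
  obtain ⟨γ, hγp, -⟩ := ((Dg.isTree_tree M).isTree.connected (Sum.inl v : (Dg.tree M).Node) (Sum.inl u)).exists_path_of_dist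
  obtain ⟨w, β, β', hw, hβ, hβ', hβw, hβ'w, hwz, hne'⟩ :=
    exists_unfolded_crossing_of_mem_path h36 K₁ K₂ m ha₀ hb₀ p hp z hz hz₁ hz₂ M hmM hv hu γ
  have hfix : ∀ d ∈ K₁ ⊓ K₂, (Dg.treeAct hc M d).hom.vertexMap w = w ∧ (Dg.treeAct hc M d).hom.branchMap β = β ∧
      (Dg.treeAct hc M d).hom.branchMap β' = β' := by
    intro d hd
    obtain ⟨hd₁, hd₂⟩ := Subgroup.mem_inf.mp hd
    obtain ⟨hfixV, hfixB⟩ := fixes_of_mem_support_path h36 M d (hv d hd₁) (hu d hd₂) γ hγp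
    exact ⟨hfixV w hw, hfixB β hβ, hfixB β' hβ'⟩
  have hπβ : (Dg.tree m).abuts ((Dg.treeTrans hmM).branchMap β) = some z := by
    rw [(Dg.treeTrans hmM).abuts_branchMap β w hβw, hwz]
  have hπβ' : (Dg.tree m).abuts ((Dg.treeTrans hmM).branchMap β') = some z := by
    rw [(Dg.treeTrans hmM).abuts_branchMap β' w hβ'w, hwz]
  exact ⟨w, β, β', hβw, hβ'w, hwz, hne', ⟨hπβ, fun g hg => hpushB hmM g β (hfix g hg).2.1⟩,
    ⟨hπβ', fun g hg => hpushB hmM g β' (hfix g hg).2.2⟩, hfix⟩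

/-- ★ **In the third regime of the trichotomy, `K₁ ⊓ K₂` has an INFINITE FIXED STAR at some vertex of EVERY deep
level.**  Let `K₁, K₂` be compact with `K₁ ⊓ K₂ ≠ 1`, fixing no common vertex of `𝒢_{∞,m}`; if the level `M ≥ m`
carries no bridge, then some vertex `z` of `𝒢_{∞,M}`, fixed by neither subgroup, carries infinitely many branches fixed
by every element of `K₁ ⊓ K₂` (the first interior vertex of an extremal path between the fixed loci, F8).
[cite: MochizukiSemiAnbd2006, Thm 3.7(iv) p.41] -/
theorem exists_infinite_fixed_star_of_no_bridge (h37 : 𝒢.Thm37Hypotheses)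
    (K₁ K₂ : Subgroup ((𝒢.galoisLevelData h37.toProp36Hypotheses).temperedPi h37.toProp36Hypotheses.isCountable))
    (hK₁ : IsCompact (K₁ : Set ((𝒢.galoisLevelData h37.toProp36Hypotheses).temperedPi h37.toProp36Hypotheses.isCountable)))
    (hK₂ : IsCompact (K₂ : Set ((𝒢.galoisLevelData h37.toProp36Hypotheses).temperedPi h37.toProp36Hypotheses.isCountable)))
    (hne : K₁ ⊓ K₂ ≠ ⊥) (M : ℕ)
    (hno : ∀ z : ((𝒢.galoisLevelData h37.toProp36Hypotheses).tree M).Vertex,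
      (∀ k ∈ K₁, ((𝒢.galoisLevelData h37.toProp36Hypotheses).treeAct h37.toProp36Hypotheses.isCountable M
        k).hom.vertexMap z = z) →
        ¬ ∀ k ∈ K₂, ((𝒢.galoisLevelData h37.toProp36Hypotheses).treeAct h37.toProp36Hypotheses.isCountable M
          k).hom.vertexMap z = z)
    (hnobr : ¬ ∃ (x y : ((𝒢.galoisLevelData h37.toProp36Hypotheses).tree M).Vertex)
        (β₁ β₂ : ((𝒢.galoisLevelData h37.toProp36Hypotheses).tree M).Branch),
      β₁ ≠ β₂ ∧ ((𝒢.galoisLevelData h37.toProp36Hypotheses).tree M).edgeOf β₁ =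
        ((𝒢.galoisLevelData h37.toProp36Hypotheses).tree M).edgeOf β₂ ∧
      ((𝒢.galoisLevelData h37.toProp36Hypotheses).tree M).abuts β₁ = some x ∧
      ((𝒢.galoisLevelData h37.toProp36Hypotheses).tree M).abuts β₂ = some y ∧
      (∀ k ∈ K₁, ((𝒢.galoisLevelData h37.toProp36Hypotheses).treeAct h37.toProp36Hypotheses.isCountable M
        k).hom.vertexMap x = x) ∧
      ∀ k ∈ K₂, ((𝒢.galoisLevelData h37.toProp36Hypotheses).treeAct h37.toProp36Hypotheses.isCountable M
        k).hom.vertexMap y = y) :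
    ∃ z : ((𝒢.galoisLevelData h37.toProp36Hypotheses).tree M).Vertex,
      (¬ ∀ k ∈ K₁, ((𝒢.galoisLevelData h37.toProp36Hypotheses).treeAct h37.toProp36Hypotheses.isCountable M
        k).hom.vertexMap z = z) ∧
      (¬ ∀ k ∈ K₂, ((𝒢.galoisLevelData h37.toProp36Hypotheses).treeAct h37.toProp36Hypotheses.isCountable M
        k).hom.vertexMap z = z) ∧
      ¬ {γ : ((𝒢.galoisLevelData h37.toProp36Hypotheses).tree M).Branch |
          ((𝒢.galoisLevelData h37.toProp36Hypotheses).tree M).abuts γ = some z ∧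
          ∀ g ∈ K₁ ⊓ K₂, ((𝒢.galoisLevelData h37.toProp36Hypotheses).treeAct h37.toProp36Hypotheses.isCountable M
            g).hom.branchMap γ = γ}.Finite := by
  classical
  have h36 := h37.toProp36Hypotheses
  let Dg := 𝒢.galoisLevelData h36
  have hc := h36.isCountable
  let D₀ : VerticialLevelData.{0} 𝒢 (𝒢.temperedPiChart h36) := verticialLevelData_temperedPiChart (h36 := h36)
  let T := Dg.tree M
  have hT := (Dg.isTree_tree M).isTree
  let A : Set T.Vertex := {a | ∀ k ∈ K₁, (Dg.treeAct hc M k).hom.vertexMap a = a}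
  let B : Set T.Vertex := {b | ∀ k ∈ K₂, (Dg.treeAct hc M k).hom.vertexMap b = b}
  obtain ⟨a₀, ha₀⟩ := D₀.exists_forall_mem_fixed_vertex_of_isCompact K₁ hK₁ M
  obtain ⟨b₀, hb₀⟩ := D₀.exists_forall_mem_fixed_vertex_of_isCompact K₂ hK₂ M
  obtain ⟨γ₀, hγ₀, -⟩ := (hT.connected (Sum.inl a₀ : T.Node) (Sum.inl b₀)).exists_path_of_dist
  obtain ⟨x, y, δ, hxA, hyB, hδ, -, hext⟩ := SemiGraph.exists_extremal_subpath A B γ₀.length γ₀ hγ₀ rfl ha₀ hb₀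
  have hxy : x ≠ y := fun h => hno x hxA (h ▸ hyB)
  obtain ⟨β₁, β₁', z, δ₁, h11, he₁, hβ₁x, hβ₁'z, -, hsupp₁⟩ := SemiGraph.exists_first_step δ rfl rfl hδ hxy
  have hzδ : (Sum.inl z : T.Node) ∈ δ.support := by rw [hsupp₁]; exact List.mem_append_right _ δ₁.start_mem_support
  have hxδ₁ : (Sum.inl x : T.Node) ∉ δ₁.support := by
    have hnd : δ.support.Nodup := (Walk.isPath_def δ).mp hδ
    rw [hsupp₁] at hnd
    exact fun h => (List.disjoint_of_nodup_append hnd) (by simp) h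
  have hzx : z ≠ x := fun h => hxδ₁ (h ▸ δ₁.start_mem_support)
  have hzA : z ∉ A := fun h => hzx ((hext z hzδ).1 h)
  have hzy : z ≠ y := by
    intro h; subst h
    exact hnobr ⟨x, z, β₁, β₁', h11, he₁, hβ₁x, hβ₁'z, hxA, hyB⟩
  have hzB : z ∉ B := fun h => hzy ((hext z hzδ).2 h)
  exact ⟨z, hzA, hzB, infinite_fixed_branches_of_mem_path h37 K₁ K₂ hK₁ hK₂ hne M hxA hyB δ hδ z hzδ hzA hzB⟩

end ProfiniteSemiGraph

end Literature.AnabelianGeometry.SemiGraphs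

end
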